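import Summits.QuantumFields.BalabanUV.Beta.KernelPermutation
import Literature.MathematicalPhysics.QuantumFieldTheory.Balaban1983to89.Beta.AveragingContoursRooted

/-!
# `BalabanUV.Beta.CombPermutationWitness` — road «FP» row PERM-COV, JET SIDE, A LOCATED OBSTRUCTION WITH A KERNEL WITNESS: Bałaban's
# AXIAL CONTOUR (the comb `AveragingContours.axial`, B7 p. 24: «first the segment moving x_d, last the one moving x₁») is NOT carried to
# itself by a permutation of the axes, so the rooted tree gauge `AveragingContoursRooted.treeGaugeAt ρ_c` — through which every comb-rooted
# averaging table of the cell (an1's `vhSAt`, `hessFFAt`, `mixFFAt`, `vh₂SAt`; an2's rooted axial dressing `pm` ∕ `pmBm` ∕ `coDressKBmAt` ∕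
# `dressBmAt`) reads the background — FAILS the permutation law at the centred root already for `d + 1 = 2`, `L = 3`

HONEST FRAMING (cell contract, verbatim): «discharging `BetaPertH` makes Bałaban's UV stability UNCONDITIONAL — a real constructive-QFT
result; it is NOT the continuum limit and NOT the Clay problem.»  THIS MODULE is a NEGATIVE bookkeeping witness ([our object], decidable
arithmetic over `ℤ`): it shows that the jet-side hypotheses (Sπ)/(Wπ) of MODULE 3 (`ResolventPermutationStep.permCovariant_flipK_TbalOf`)
CANNOT be obtained for comb-rooted tables by transport of structure — the method that gives the centred REFLECTION rows (a reflection of one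
axis through the block centre maps the comb of axis order `0 < 1 < … < d` to itself; a permutation maps it to the comb of the permuted
order, a different tree).  It does NOT claim that the assembled step kernels `TbalOf Lc JsRowD1 j` violate `B12Beta.PermCovariant`: for
gauge-invariant targets that is a TREE-INDEPENDENCE statement (the Ward ∕ gauge-covariance content named, for the dressed family under
reflections, in the docstring of `Beta.ResolventReflection`, «THE DRESSED FAMILY») — OPEN, not addressed here.  What transport DOES give
(comb-free constituents: the typed `U = 1` resolvents `KInv N` ∕ `KInvStep Lc j`, straight-contour block sums, the Wilson stencils) is MODULES
1–3 (`KernelPermutation` p229500, `ResolventPermutation` p229781, `ResolventPermutationStep` p230043).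
CONTENT: `combPull σ A κ z := A (σ κ) (σ•z)` (the pull-back of an integer 1-form, = MODULE 2's `P1` read over `ℤ`); **`treeGaugeAt_comb_witness`**:
at `d + 1 = 2`, `L = 3`, centred root `ρ_c = (1,1)` (= `toSite (ctrOff 2 3)`, a FIXED POINT of every axis permutation), `σ := swap 0 1`, the
indicator 1-form `A` of the bond `(1, (1,0))` and the point `x = (0,0) = σ•x`:
`treeGaugeAt ρ_c (combPull σ A) 3 x = 0 ≠ −1 = treeGaugeAt ρ_c A 3 (σ•x)` (by `decide`); hence **`treeGaugeAt_not_permCovariant`**: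
`¬ ∀ σ A x, treeGaugeAt ρ_c (combPull σ A) 3 x = treeGaugeAt ρ_c A 3 (σ•x)`.  REPAIR CENSUS (for the road FP owner; nothing here decides it):
(R1) symmetrise the averaging contours over the `(d+1)!` axis orders — a different (hyperoctahedrally exact) averaging operation, i.e. a different
wall literal; (R2) tree-independence of the gauge-invariant targets — Ward content, wall-class; (R3) the owner's H2 design at the fixed point in a
COVARIANT slice with unconstrained legs («no block-constrained leg is ever tabled») — needs only MODULES 1–3 + comb-free tables; (R4) run
`MarginalUniqueness.cubic_unique` on reflections + Bose + Ward alone — does NOT close by itself (an axis-weighted germ `Σ_μ a_μ(…)` passes flips and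
Bose), so some form of (R1)–(R3) is needed for the permutation letter.
Unit `b2b-balaban-beta-d1-formalise-leaf-01` (gen 7), 2026-08-20; claim table `HOME/b2b-balaban-beta-d1-p3/LEAVES-FP.md` sub-row PERM-COV.
HONEST DEPENDENCY (verbatim): «continuum YM on T⁴ ⇐ BetaPertH ∧ nine spine estimates (0/9 proved); BetaPertH ⇐ (D1) ∧ (D4) ∧ CAP+tail;
G-an2-4 gates asym, D1 and NE2/3/4.»  ABSOLUTE RULE (cell, verbatim): «No internally-minted statement may enter as a cited fact. Every
hypothesis is either kernel-proved in this package or a verbatim quotation of a PUBLISHED theorem with page reference.»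
-/

namespace Summit.QuantumFields.BalabanUV.Beta.CombPermutationWitness

open Literature.MathematicalPhysics.QuantumFieldTheory.Balaban1983to89.Beta
open AffineAveraging (Form1 Site)
open AveragingContoursRooted (treeGaugeAt)
open Summit.QuantumFields.BalabanUV.Beta.KernelPermutation (psite)

/-- [our object] The pull-back of an integer-valued 1-form under the axis permutation `σ` (MODULE 2's `P1`, read over `ℤ`):
the `κ`-bond at `z` is read as the `σ κ`-bond at `σ•z`. -/
def combPull {D : ℕ} (σ : Equiv.Perm (Fin D)) (A : Form1 D ℤ) : Form1 D ℤ := fun κ z => A (σ κ) (psite σ z)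

/-- [our object] The witness data: the swap of the two axes of `ℤ²`. -/
def σw : Equiv.Perm (Fin 2) := Equiv.swap 0 1

/-- [our object] The witness 1-form: the indicator of the bond in direction `1` based at `(1, 0)` — a bond of the comb from the centred root
`(1,1)` to `(0,0)` (which moves the coordinate `x₁` FIRST), not of the permuted comb (which moves `x₀` first). -/
def Aw : Form1 2 ℤ := fun κ z => if κ = 1 ∧ z = ![1, 0] then 1 else 0

/-- [our object] The centred root of the `3`-block (= `toSite (ctrOff 2 3)`, all coordinates `(3 − 1)/2 = 1`): a fixed point of `σw`. -/
def ρw : Site 2 := ![1, 1]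

/-- [our object] **THE KERNEL WITNESS**: at the centred root, the tree gauge of the pulled-back witness form at `x = (0,0)` is `0`, while the tree
gauge of the witness form at `σ•x = (0,0)` is `−1`. -/
theorem treeGaugeAt_comb_witness :
    treeGaugeAt ρw (combPull σw Aw) 3 ![0, 0] = 0 ∧ treeGaugeAt ρw Aw 3 (psite σw ![0, 0]) = -1 := by
  decide

/-- [our object] **THE ROOTED TREE GAUGE IS NOT PERMUTATION-COVARIANT** (centred root, `d + 1 = 2`, `L = 3`): transport of structure along an
axis permutation does not carry Bałaban's comb to itself. -/
theorem treeGaugeAt_not_permCovariant :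
    ¬ ∀ (σ : Equiv.Perm (Fin 2)) (A : Form1 2 ℤ) (x : Site 2), treeGaugeAt ρw (combPull σ A) 3 x = treeGaugeAt ρw A 3 (psite σ x) := by
  intro h
  have h1 := h σw Aw ![0, 0]
  rw [treeGaugeAt_comb_witness.1, treeGaugeAt_comb_witness.2] at h1
  exact absurd h1 (by decide)

end Summit.QuantumFields.BalabanUV.Beta.CombPermutationWitness
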